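import Summits.QuantumFields.YangMills.Theorems.BalabanLadderIRTwistedSlabExpChart
import Summits.QuantumFields.YangMills.Theorems.BalabanLadderIRTwistedSlabVacuumHessian
import Literature.Analysis.Asymptotics.LaplaceMethodMultivariate
import HarnessLib

/-!
# Second-order Taylor expansion of the twisted Wilson action in the exponential chart; the Hessian BILINEAR FORM at a classical
# vacuum is the covariant curl form on `su(N)`-directions and is coercive on the Coulomb slice (pointwise `hS2`∕`A(p)` data of the
# Morse–Bott Laplace method, in T1's currency)

HELPER toward stub **T1** `TwistedSlabAnchor` (LINE `twisted-slab-continuity`, crux `IRcof` stmt-QuantumFields-26930, census row 43;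
LEAD prover ym-ir-line-tsc-p1 g3; `--supports` the crux, `--as helper`).  Sequel of `…TwistedSlabExpChart` (K4: `chartAction U c` is
`C^∞`, its line restriction is `lineAction`) and of K3 (`…TwistedSlabHessian` ∕ `…LadderHessian` ∕ `…VacuumHessian`); consumes lit-4's
`Literature.Analysis.Asymptotics.isLittleO_taylor_two` and `iteratedDeriv_two_along_line` (p663760 ∕ p664730) BY NAME.
* §1 `hasFDerivAt_chartAction`, `hasFDerivAt_fderiv_chartAction` (the `C^∞` data as `HasFDerivAt` data);
  ★ `isLittleO_chartAction_taylor_two`: at EVERY base point `a₀`,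
  `chartAction(a) = chartAction(a₀) + D(a₀)(a − a₀) + ½ D²(a₀)(a − a₀, a − a₀) + o(‖a − a₀‖²)` (`D = fderiv`, `D² = fderiv ∘ fderiv`).
* §2 ★ `fderiv_fderiv_chartAction_apply_self`: `D²(0)(a, a) = d²/dt²|₀ lineAction U a c` (the Hessian bilinear form on the diagonal IS the
  line Hessian of K3); hence at a unitary background EATING the phases and along skew-Hermitian `a`: ★★ `hessian_chartAction_eq_curlForm`
  (`D²(0)(a,a) = Σ_x Σ_{μ<ν} S(∇⁺_μ a_ν − ∇⁺_ν a_μ)(x)`), and at the decorated twist-eating ladders ∕ at EVERY classical vacuum of the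
  e₂-projected slab weight (`SU(N)`, `k` a unit): ★★★ `hessian_chartAction_coercive_ladder` ∕ `hessian_coercive_of_vacuum_specialUnitary`:
  `4 sin²(π/(N(m+1))) · Σ_x Σ_μ S(a_μ x) ≤ D²(0)(a, a)` on traceless skew-Hermitian Coulomb-gauge `a`, uniformly in the long extents.
* §3 `sum_hsS_ge_norm_sq`: in the (sup-over-links, Frobenius-per-link) norm of the chart, `‖a‖² ≤ Σ_x Σ_μ S(a_μ x)`, so the coercivity also
  holds in the form `4 sin²(π/(N(m+1))) · ‖a‖² ≤ D²(0)(a, a)` (`hessian_chartAction_coercive_norm_ladder`) — the shape of the hypotheses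
  `hpos`∕`hcoer` of `tendsto_laplaceMethod_of_hasFDerivAt` ∕ `tendsto_laplaceMethod_fibred`, per vacuum.
NOT here (honest scope): uniformity of the `o(‖a‖²)` over the critical orbit (compactness), the restriction to the real subspace
`su(N)^E ∩ ker div` as an inner-product space `V` with Lebesgue measure, the Haar density and the slice Jacobian (M1 proper), anything
uniform in `β` (M3), the cluster expansion (M4); T1-box 0∕1, T1 proper 0∕1.

HONEST FRAMING: calculus on one box; nothing here bears on `IRcof`, `IR`, or the Yang–Mills mass gap (Clay: NOT proved); R4 =
`BalabanLadder.UV` only.  References: K. W. Breitung, LNM 1592 (1994) Thm 41 and (5.34); M. García Pérez, A. González-Arroyo, M. Okawa,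
JHEP 10 (2017) 150 §2.3, §2.5.
-/

set_option autoImplicit false

noncomputable section

open scoped Matrix Matrix.Norms.Frobenius Topology
open Finset NormedSpace Filter Asymptotics
open Literature.MathematicalPhysics.QuantumFieldTheory Literature.MathematicalPhysics.QuantumLattice
open Literature.MathematicalPhysics.QuantumLattice.WilsonSecondVariation
open Literature.Analysis.Asymptotics

namespace Summit.QuantumFields.YangMills.Cruxes.IRcof.TwistedSlab

variable {N : ℕ} {n₀ n₁ n₂ n₃ : ℕ}

/-! ## §1 The `C^∞` data as `HasFDerivAt` data; second-order Taylor expansion -/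

section Taylor

variable (U : FinTorusSite n₀ n₁ n₂ n₃ × Fin 4 → Matrix (Fin N) (Fin N) ℂ)
  (c : FinTorusSite n₀ n₁ n₂ n₃ → Fin 4 → Fin 4 → ℂ)

/-- The chart action has its Fréchet derivative everywhere. [folklore] -/
theorem hasFDerivAt_chartAction (a : Fin 4 → FinTorusSite n₀ n₁ n₂ n₃ → Matrix (Fin N) (Fin N) ℂ) :
    HasFDerivAt (chartAction U c) (fderiv ℝ (chartAction U c) a) a :=
  ((differentiable_chartAction U c) a).hasFDerivAt

/-- The second Fréchet derivative exists everywhere (the derivative is again `C^∞`, `ContDiff.fderiv_right`). [folklore] -/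
theorem hasFDerivAt_fderiv_chartAction (a : Fin 4 → FinTorusSite n₀ n₁ n₂ n₃ → Matrix (Fin N) (Fin N) ℂ) :
    HasFDerivAt (fderiv ℝ (chartAction U c)) (fderiv ℝ (fderiv ℝ (chartAction U c)) a) a := by
  have h2 := (contDiff_chartAction U c).fderiv_right (m := ⊤) le_top
  exact ((h2.differentiable WithTop.top_ne_zero) a).hasFDerivAt

/-- ★ **Second-order Taylor expansion of the twisted Wilson action in the exponential chart**, at every base point `a₀`:
`chartAction(a) − chartAction(a₀) − D(a₀)(a − a₀) − ½ D²(a₀)(a − a₀, a − a₀) = o(‖a − a₀‖²)` (lit-4's `isLittleO_taylor_two`).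
[cite: Breitung1994, Thm 41 proof (second-order expansion at the critical point)] -/
theorem isLittleO_chartAction_taylor_two (a₀ : Fin 4 → FinTorusSite n₀ n₁ n₂ n₃ → Matrix (Fin N) (Fin N) ℂ) :
    (fun a => chartAction U c a - chartAction U c a₀ - fderiv ℝ (chartAction U c) a₀ (a - a₀) -
        (1 / 2) * fderiv ℝ (fderiv ℝ (chartAction U c)) a₀ (a - a₀) (a - a₀)) =o[𝓝 a₀]
      fun a => ‖a - a₀‖ ^ 2 :=
  isLittleO_taylor_two (Eventually.of_forall fun a => hasFDerivAt_chartAction U c a) (hasFDerivAt_fderiv_chartAction U c a₀)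

/-! ## §2 The Hessian bilinear form on the diagonal is the line Hessian -/

/-- ★ **The Hessian bilinear form on the diagonal IS the line Hessian of K3**: `D²chartAction(0)(a, a) = d²/dt²|₀ lineAction U a c`
(lit-4's `iteratedDeriv_two_along_line`). [cite: Breitung1994, Thm 41 proof, (5.34)] -/
theorem fderiv_fderiv_chartAction_apply_self (a : Fin 4 → FinTorusSite n₀ n₁ n₂ n₃ → Matrix (Fin N) (Fin N) ℂ) :
    fderiv ℝ (fderiv ℝ (chartAction U c)) 0 a a = iteratedDeriv 2 (lineAction U a c) 0 := by
  have h := iteratedDeriv_two_along_line (Eventually.of_forall fun a => hasFDerivAt_chartAction U c a)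
    (hasFDerivAt_fderiv_chartAction U c 0) a
  have e : (fun t : ℝ => chartAction U c ((0 : Fin 4 → FinTorusSite n₀ n₁ n₂ n₃ → Matrix (Fin N) (Fin N) ℂ) + t • a)) = lineAction U a c := by
    funext t
    rw [zero_add]
    exact chartAction_smul U c a t
  rw [e] at h
  exact h.symm

variable {U c} {a : Fin 4 → FinTorusSite n₀ n₁ n₂ n₃ → Matrix (Fin N) (Fin N) ℂ}

/-- ★★ **At a twist-eating unitary background the Hessian bilinear form on skew-Hermitian directions is the covariant curl form**:
`D²chartAction(0)(a, a) = Σ_x Σ_{μ<ν} S(∇⁺_μ a_ν − ∇⁺_ν a_μ)(x)`. [cite: GarciaperezGonzalezarroyoOkawa2017, §2.3] -/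
theorem hessian_chartAction_eq_curlForm (hU : ∀ e, U e ∈ Matrix.unitaryGroup (Fin N) ℂ)
    (hc : ∀ x μ ν, star (c x μ ν) * c x μ ν = 1)
    (heat : ∀ (x : FinTorusSite n₀ n₁ n₂ n₃) (μ ν : Fin 4), μ < ν → bgPlaq U x μ ν = star (c x μ ν) • (1 : Matrix (Fin N) (Fin N) ℂ))
    (hskew : ∀ μ x, (a μ x)ᴴ = -a μ x) :
    fderiv ℝ (fderiv ℝ (chartAction U c)) 0 a a =
      ∑ x, ∑ q : {q : Fin 4 × Fin 4 // q.1 < q.2}, ((((covDeriv U q.1.1 (a q.1.2) x - covDeriv U q.1.2 (a q.1.1) x))ᴴ *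
        (covDeriv U q.1.1 (a q.1.2) x - covDeriv U q.1.2 (a q.1.1) x)).trace).re := by
  rw [fderiv_fderiv_chartAction_apply_self, iteratedDeriv_two_lineAction hU hc heat hskew]

/-- The Hessian bilinear form is non-negative on skew-Hermitian directions at a twist eater (a local minimum). [folklore] -/
theorem hessian_chartAction_nonneg (hU : ∀ e, U e ∈ Matrix.unitaryGroup (Fin N) ℂ)
    (hc : ∀ x μ ν, star (c x μ ν) * c x μ ν = 1)
    (heat : ∀ (x : FinTorusSite n₀ n₁ n₂ n₃) (μ ν : Fin 4), μ < ν → bgPlaq U x μ ν = star (c x μ ν) • (1 : Matrix (Fin N) (Fin N) ℂ))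
    (hskew : ∀ μ x, (a μ x)ᴴ = -a μ x) :
    0 ≤ fderiv ℝ (fderiv ℝ (chartAction U c)) 0 a a := by
  rw [hessian_chartAction_eq_curlForm hU hc heat hskew]
  exact Finset.sum_nonneg fun x _ => Finset.sum_nonneg fun q _ => re_trace_conjTranspose_mul_self_nonneg _

variable [NeZero N] {m : ℕ}

/-- ★★★ **Coercivity of the Hessian bilinear form on the Coulomb slice at the decorated twist-eating ladders** (`A, B` a unitary Weyl
pair `AB = ω·BA`, `ω` primitive; phases `c₂, c₃`; any box `(m+1) × (m+1) × n₂ × n₃`): for traceless skew-Hermitian `a` with `div a = 0`,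
`4 sin²(π/(N(m+1))) · Σ_x Σ_μ S(a_μ x) ≤ D²chartAction(0)(a, a)`. [cite: GarciaperezGonzalezarroyoOkawa2017, §2.2, §2.5]
[cite: GarciaperezGonzalezarroyoOkawa2014, §3] -/
theorem hessian_chartAction_coercive_ladder {n₂' n₃' : ℕ} {A B : Matrix (Fin N) (Fin N) ℂ} {ω : ℂ}
    (hAu : A ∈ Matrix.unitaryGroup (Fin N) ℂ) (hBu : B ∈ Matrix.unitaryGroup (Fin N) ℂ) (hω : IsPrimitiveRoot ω N) (hAB : A * B = ω • (B * A))
    {c₂ c₃ : ℂ} (hc₂ : star c₂ * c₂ = 1) (hc₃ : star c₃ * c₃ = 1)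
    {c : FinTorusSite (m + 1) (m + 1) n₂' n₃' → Fin 4 → Fin 4 → ℂ} (hc : ∀ x μ ν, star (c x μ ν) * c x μ ν = 1)
    (heat : ∀ (x : FinTorusSite (m + 1) (m + 1) n₂' n₃') (μ ν : Fin 4), μ < ν →
      bgPlaq (ladderField ![A, B, c₂ • (1 : Matrix (Fin N) (Fin N) ℂ), c₃ • (1 : Matrix (Fin N) (Fin N) ℂ)]) x μ ν =
        star (c x μ ν) • (1 : Matrix (Fin N) (Fin N) ℂ))
    {a : Fin 4 → FinTorusSite (m + 1) (m + 1) n₂' n₃' → Matrix (Fin N) (Fin N) ℂ}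
    (hskew : ∀ μ x, (a μ x)ᴴ = -a μ x) (htr : ∀ μ x, (a μ x).trace = 0)
    (hdiv : ∀ x, covDiv (ladderField ![A, B, c₂ • (1 : Matrix (Fin N) (Fin N) ℂ), c₃ • (1 : Matrix (Fin N) (Fin N) ℂ)]) a x = 0) :
    4 * Real.sin (Real.pi / ((N : ℝ) * (m + 1 : ℕ))) ^ 2 * ∑ x, ∑ μ, (((a μ x)ᴴ * a μ x).trace).re ≤
      fderiv ℝ (fderiv ℝ (chartAction (ladderField ![A, B, c₂ • (1 : Matrix (Fin N) (Fin N) ℂ),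
        c₃ • (1 : Matrix (Fin N) (Fin N) ℂ)]) c)) 0 a a := by
  rw [fderiv_fderiv_chartAction_apply_self]
  exact ladder_hessian_gap hAu hBu hω hAB hc₂ hc₃ hc heat hskew htr hdiv

/-! ### Gauge covariance of the line action at the matrix level (no `SU(N)`-valued exponential needed) -/

omit [NeZero N] in
/-- **Gauge covariance of the perturbed plaquette**: at `g • L` with fluctuation `a` it is the `g(x)`-conjugate of the perturbed plaquette at
`L` with the conjugated fluctuation `a^g`. [folklore] -/
theorem linePlaq_gaugeAct {n₀' n₁' n₂' n₃' : ℕ} (g : FinTorusSite n₀' n₁' n₂' n₃' → Matrix.specialUnitaryGroup (Fin N) ℂ)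
    (L : FinTorusSite n₀' n₁' n₂' n₃' × Fin 4 → Matrix.specialUnitaryGroup (Fin N) ℂ)
    (a : Fin 4 → FinTorusSite n₀' n₁' n₂' n₃' → Matrix (Fin N) (Fin N) ℂ) (x : FinTorusSite n₀' n₁' n₂' n₃') (μ ν : Fin 4) (t : ℝ) :
    linePlaq (fun e => ((gaugeAct g L e : Matrix.specialUnitaryGroup (Fin N) ℂ) : Matrix (Fin N) (Fin N) ℂ)) a x μ ν t =
      (g x : Matrix (Fin N) (Fin N) ℂ) * linePlaq (fun e => ((L e : Matrix.specialUnitaryGroup (Fin N) ℂ) : Matrix (Fin N) (Fin N) ℂ))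
        (conjFluct (fun y => (g y : Matrix (Fin N) (Fin N) ℂ)) a) x μ ν t * ((g x : Matrix.specialUnitaryGroup (Fin N) ℂ) : Matrix (Fin N) (Fin N) ℂ)ᴴ := by
  -- each perturbed link at `g • L` is `g(y) · (perturbed link at L with a^g) · g(y+e_μ)ᴴ`
  have hW : ∀ (μ : Fin 4) (y : FinTorusSite n₀' n₁' n₂' n₃'),
      exp (t • a μ y) * ((gaugeAct g L (y, μ) : Matrix.specialUnitaryGroup (Fin N) ℂ) : Matrix (Fin N) (Fin N) ℂ) =
        (g y : Matrix (Fin N) (Fin N) ℂ) * (exp (t • conjFluct (fun y => (g y : Matrix (Fin N) (Fin N) ℂ)) a μ y) *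
          ((L (y, μ) : Matrix.specialUnitaryGroup (Fin N) ℂ) : Matrix (Fin N) (Fin N) ℂ)) *
          ((g (y.shift μ) : Matrix.specialUnitaryGroup (Fin N) ℂ) : Matrix (Fin N) (Fin N) ℂ)ᴴ := by
    intro μ y
    have hgy : ((g y : Matrix.specialUnitaryGroup (Fin N) ℂ) : Matrix (Fin N) (Fin N) ℂ)ᴴ * (g y : Matrix (Fin N) (Fin N) ℂ) = 1 := (g y).2.1.1
    have hgy' : (g y : Matrix (Fin N) (Fin N) ℂ) * ((g y : Matrix.specialUnitaryGroup (Fin N) ℂ) : Matrix (Fin N) (Fin N) ℂ)ᴴ = 1 := (g y).2.1.2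
    have hexp : exp (t • conjFluct (fun y => (g y : Matrix (Fin N) (Fin N) ℂ)) a μ y) =
        ((g y : Matrix.specialUnitaryGroup (Fin N) ℂ) : Matrix (Fin N) (Fin N) ℂ)ᴴ * exp (t • a μ y) * (g y : Matrix (Fin N) (Fin N) ℂ) := by
      simp only [conjFluct]; exact (conjTranspose_mul_exp_smul_mul hgy hgy' t).symm
    rw [coe_gaugeAct_apply, hexp]
    calc exp (t • a μ y) * ((g y : Matrix (Fin N) (Fin N) ℂ) * (L (y, μ) : Matrix (Fin N) (Fin N) ℂ) *
          ((g (y.shift μ) : Matrix.specialUnitaryGroup (Fin N) ℂ) : Matrix (Fin N) (Fin N) ℂ)ᴴ)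
        = ((g y : Matrix (Fin N) (Fin N) ℂ) * ((g y : Matrix.specialUnitaryGroup (Fin N) ℂ) : Matrix (Fin N) (Fin N) ℂ)ᴴ) * exp (t • a μ y) *
            (g y : Matrix (Fin N) (Fin N) ℂ) * (L (y, μ) : Matrix (Fin N) (Fin N) ℂ) *
            ((g (y.shift μ) : Matrix.specialUnitaryGroup (Fin N) ℂ) : Matrix (Fin N) (Fin N) ℂ)ᴴ := by
              rw [hgy', Matrix.one_mul]; simp only [Matrix.mul_assoc]
      _ = _ := by simp only [Matrix.mul_assoc]
  have hcancel : ∀ (y : FinTorusSite n₀' n₁' n₂' n₃') (M : Matrix (Fin N) (Fin N) ℂ),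
      ((g y : Matrix.specialUnitaryGroup (Fin N) ℂ) : Matrix (Fin N) (Fin N) ℂ)ᴴ * ((g y : Matrix (Fin N) (Fin N) ℂ) * M) = M := fun y M => by
    have hgy : ((g y : Matrix.specialUnitaryGroup (Fin N) ℂ) : Matrix (Fin N) (Fin N) ℂ)ᴴ * (g y : Matrix (Fin N) (Fin N) ℂ) = 1 := (g y).2.1.1
    rw [← Matrix.mul_assoc, hgy, Matrix.one_mul]
  simp only [linePlaq, plaqHol, hW]
  rw [FinTorusSite.shift_comm x ν μ]
  simp only [Matrix.conjTranspose_mul, Matrix.conjTranspose_conjTranspose, Matrix.mul_assoc, hcancel]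

omit [NeZero N] in
/-- ★ **Gauge covariance of the line action**: `lineAction (↑(g • L)) a c = lineAction (↑L) a^g c`. [folklore] -/
theorem lineAction_gaugeAct {n₀' n₁' n₂' n₃' : ℕ} (g : FinTorusSite n₀' n₁' n₂' n₃' → Matrix.specialUnitaryGroup (Fin N) ℂ)
    (L : FinTorusSite n₀' n₁' n₂' n₃' × Fin 4 → Matrix.specialUnitaryGroup (Fin N) ℂ)
    (a : Fin 4 → FinTorusSite n₀' n₁' n₂' n₃' → Matrix (Fin N) (Fin N) ℂ) (c : FinTorusSite n₀' n₁' n₂' n₃' → Fin 4 → Fin 4 → ℂ) :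
    lineAction (fun e => ((gaugeAct g L e : Matrix.specialUnitaryGroup (Fin N) ℂ) : Matrix (Fin N) (Fin N) ℂ)) a c =
      lineAction (fun e => ((L e : Matrix.specialUnitaryGroup (Fin N) ℂ) : Matrix (Fin N) (Fin N) ℂ))
        (conjFluct (fun y => (g y : Matrix (Fin N) (Fin N) ℂ)) a) c := by
  funext t
  refine Finset.sum_congr rfl fun x _ => Finset.sum_congr rfl fun q _ => ?_
  have hgx : ((g x : Matrix.specialUnitaryGroup (Fin N) ℂ) : Matrix (Fin N) (Fin N) ℂ)ᴴ * (g x : Matrix (Fin N) (Fin N) ℂ) = 1 := (g x).2.1.1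
  rw [linePlaq_gaugeAct, Matrix.trace_smul, Matrix.trace_smul, Matrix.trace_mul_cycle, hgx, Matrix.one_mul]

/-- ★★★ **Coercivity at EVERY classical vacuum of the e₂-projected slab weight** (`SU(N)`, `k` a unit, box `(m+1)² × (m₂+1) × (m₃+1)`):
if `U` has zero twisted action (fundamental representation, magnetic slab tensor `slabTwist (ω^k·1) 1`), then on traceless skew-Hermitian
`a` in the Coulomb slice of `U`: `4 sin²(π/(N(m+1))) · Σ_x Σ_μ S(a_μ x) ≤ D²chartAction_{↑U, slabTwistPhase k}(0)(a, a)` — the transversal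
Morse–Bott non-degeneracy of the whole critical manifold, as a statement about the HESSIAN BILINEAR FORM of a `C^∞` function, constants
uniform in the long extents. [cite: GarciaperezGonzalezarroyoOkawa2017, §2.2, §2.3, §2.5] [cite: Gonzalezarroyo1998, §4.2] -/
theorem hessian_coercive_of_vacuum_specialUnitary {m₂ m₃ : ℕ} {k : ZMod N} (hk : IsUnit k)
    (U : FinTorusSite (m + 1) (m + 1) (m₂ + 1) (m₃ + 1) × Fin 4 → Matrix.specialUnitaryGroup (Fin N) ℂ)
    (hU : ∑ x : FinTorusSite (m + 1) (m + 1) (m₂ + 1) (m₃ + 1), ∑ q : {q : Fin 4 × Fin 4 // q.1 < q.2},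
      ((N : ℝ) - (fundamentalRep (Fin N) (tHooftTwistTensor (slabTwist (suCenter N k : Matrix.specialUnitaryGroup (Fin N) ℂ) 1)
        x q.1.1 q.1.2 * finTorusPlaquette U x q.1.1 q.1.2)).trace.re) = 0)
    {a : Fin 4 → FinTorusSite (m + 1) (m + 1) (m₂ + 1) (m₃ + 1) → Matrix (Fin N) (Fin N) ℂ}
    (hskew : ∀ μ x, (a μ x)ᴴ = -a μ x) (htr : ∀ μ x, (a μ x).trace = 0)
    (hdiv : ∀ x, covDiv (fun e => ((U e : Matrix.specialUnitaryGroup (Fin N) ℂ) : Matrix (Fin N) (Fin N) ℂ)) a x = 0) :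
    4 * Real.sin (Real.pi / ((N : ℝ) * (m + 1 : ℕ))) ^ 2 * ∑ x, ∑ μ, (((a μ x)ᴴ * a μ x).trace).re ≤
      fderiv ℝ (fderiv ℝ (chartAction (fun e => ((U e : Matrix.specialUnitaryGroup (Fin N) ℂ) : Matrix (Fin N) (Fin N) ℂ))
        (slabTwistPhase k))) 0 a a := by
  rw [fderiv_fderiv_chartAction_apply_self]
  -- K2: a reference pair and the classification of the zero set
  obtain ⟨B, A, hBA⟩ := exists_pair_commutator_eq_suCenter (N := N) k
  obtain ⟨g, i, j, rfl⟩ := (twistedAction_eq_zero_iff_exists_gaugeAct_ladder_specialUnitary hk hBA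
    (fundamentalRep_mem_unitaryGroup (n := Fin N)) (fundamentalRep_injective (Fin N)) U).1 hU
  set L := ladderConfig (n₀ := m + 1) (n₁ := m + 1) (n₂ := m₂ + 1) (n₃ := m₃ + 1)
    ![A, B, (suCenter N i : Matrix.specialUnitaryGroup (Fin N) ℂ), (suCenter N j : Matrix.specialUnitaryGroup (Fin N) ℂ)] with hL
  have hg : ∀ y, ((g y : Matrix.specialUnitaryGroup (Fin N) ℂ) : Matrix (Fin N) (Fin N) ℂ) ∈ Matrix.unitaryGroup (Fin N) ℂ := fun y => (g y).2.1
  rw [lineAction_gaugeAct g L a, ← sum_hsS_conjFluct hg a]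
  -- the Coulomb condition transported to the ladder frame
  have hdiv' : ∀ x, covDiv (fun e => ((L e : Matrix.specialUnitaryGroup (Fin N) ℂ) : Matrix (Fin N) (Fin N) ℂ))
      (conjFluct (fun y => (g y : Matrix (Fin N) (Fin N) ℂ)) a) x = 0 := by
    intro x
    have hx := hdiv x
    rw [covDiv_gaugeAct g L a x] at hx
    have hgx : ((g x : Matrix.specialUnitaryGroup (Fin N) ℂ) : Matrix (Fin N) (Fin N) ℂ)ᴴ * (g x : Matrix (Fin N) (Fin N) ℂ) = 1 := (g x).2.1.1
    have key : ((g x : Matrix.specialUnitaryGroup (Fin N) ℂ) : Matrix (Fin N) (Fin N) ℂ)ᴴ *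
        ((g x : Matrix (Fin N) (Fin N) ℂ) * covDiv (fun e => ((L e : Matrix.specialUnitaryGroup (Fin N) ℂ) : Matrix (Fin N) (Fin N) ℂ))
          (conjFluct (fun y => (g y : Matrix (Fin N) (Fin N) ℂ)) a) x * ((g x : Matrix.specialUnitaryGroup (Fin N) ℂ) : Matrix (Fin N) (Fin N) ℂ)ᴴ) *
        (g x : Matrix (Fin N) (Fin N) ℂ) =
        covDiv (fun e => ((L e : Matrix.specialUnitaryGroup (Fin N) ℂ) : Matrix (Fin N) (Fin N) ℂ))
          (conjFluct (fun y => (g y : Matrix (Fin N) (Fin N) ℂ)) a) x := by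
      calc _ = (((g x : Matrix.specialUnitaryGroup (Fin N) ℂ) : Matrix (Fin N) (Fin N) ℂ)ᴴ * (g x : Matrix (Fin N) (Fin N) ℂ)) *
          covDiv (fun e => ((L e : Matrix.specialUnitaryGroup (Fin N) ℂ) : Matrix (Fin N) (Fin N) ℂ))
            (conjFluct (fun y => (g y : Matrix (Fin N) (Fin N) ℂ)) a) x *
          (((g x : Matrix.specialUnitaryGroup (Fin N) ℂ) : Matrix (Fin N) (Fin N) ℂ)ᴴ * (g x : Matrix (Fin N) (Fin N) ℂ)) := by
            simp only [Matrix.mul_assoc]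
        _ = _ := by rw [hgx, Matrix.one_mul, Matrix.mul_one]
    rw [← key, hx, Matrix.mul_zero, Matrix.zero_mul]
  -- the ladder frame: K3 at the decorated twist-eating ladder
  have hLcoe : (fun e => ((L e : Matrix.specialUnitaryGroup (Fin N) ℂ) : Matrix (Fin N) (Fin N) ℂ)) =
      ladderField ![(A : Matrix (Fin N) (Fin N) ℂ), (B : Matrix (Fin N) (Fin N) ℂ), centerPhase N i • (1 : Matrix (Fin N) (Fin N) ℂ),
        centerPhase N j • (1 : Matrix (Fin N) (Fin N) ℂ)] := coe_ladderConfig_pair A B i j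
  rw [hLcoe] at hdiv' ⊢
  exact ladder_hessian_gap (Matrix.specialUnitaryGroup_le_unitaryGroup A.2) (Matrix.specialUnitaryGroup_le_unitaryGroup B.2)
    (isPrimitiveRoot_star_centerPhase hk) (coe_mul_eq_smul_of_commutator_eq hBA) (star_centerPhase_mul_self i)
    (star_centerPhase_mul_self j) (star_slabTwistPhase_mul_self k) (fun x μ ν hμν => ladder_eats_slabTwistPhase hBA i j x μ ν hμν)
    (conjFluct_skew hskew) (conjFluct_trace hg htr) hdiv'

end Taylor

/-! ## §3 The sup norm of the chart is dominated by the Hilbert–Schmidt mass -/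

section Norm

/-- `‖a‖² ≤ Σ_x Σ_μ S(a_μ x)` in the chart's norm (sup over links of the Frobenius norm): the coercivity of §2 also holds in the form
`4 sin²(π/(N(m+1))) · ‖a‖² ≤ D²(0)(a, a)`. [folklore] -/
theorem norm_sq_le_sum_hsS (a : Fin 4 → FinTorusSite n₀ n₁ n₂ n₃ → Matrix (Fin N) (Fin N) ℂ) :
    ‖a‖ ^ 2 ≤ ∑ x, ∑ μ, (((a μ x)ᴴ * a μ x).trace).re := by
  have hS : ∀ μ x, ‖a μ x‖ ^ 2 = (((a μ x)ᴴ * a μ x).trace).re := fun μ x => frobenius_norm_sq_eq_hsS (a μ x)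
  have hnn : 0 ≤ ∑ x, ∑ μ, (((a μ x)ᴴ * a μ x).trace).re :=
    Finset.sum_nonneg fun x _ => Finset.sum_nonneg fun μ _ => re_trace_conjTranspose_mul_self_nonneg _
  have hle : ∀ μ x, ‖a μ x‖ ≤ Real.sqrt (∑ y, ∑ ν, (((a ν y)ᴴ * a ν y).trace).re) := by
    intro μ x
    refine Real.le_sqrt_of_sq_le ?_
    rw [hS]
    calc (((a μ x)ᴴ * a μ x).trace).re ≤ ∑ ν, (((a ν x)ᴴ * a ν x).trace).re :=
          Finset.single_le_sum (f := fun ν => (((a ν x)ᴴ * a ν x).trace).re)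
            (fun ν _ => re_trace_conjTranspose_mul_self_nonneg _) (Finset.mem_univ μ)
      _ ≤ ∑ y, ∑ ν, (((a ν y)ᴴ * a ν y).trace).re :=
          Finset.single_le_sum (f := fun y => ∑ ν, (((a ν y)ᴴ * a ν y).trace).re)
            (fun y _ => Finset.sum_nonneg fun ν _ => re_trace_conjTranspose_mul_self_nonneg _) (Finset.mem_univ x)
  have hn : ‖a‖ ≤ Real.sqrt (∑ y, ∑ ν, (((a ν y)ᴴ * a ν y).trace).re) := by
    refine (pi_norm_le_iff_of_nonneg (Real.sqrt_nonneg _)).2 fun μ => ?_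
    exact (pi_norm_le_iff_of_nonneg (Real.sqrt_nonneg _)).2 fun x => hle μ x
  calc ‖a‖ ^ 2 ≤ (Real.sqrt (∑ y, ∑ ν, (((a ν y)ᴴ * a ν y).trace).re)) ^ 2 := by
        exact pow_le_pow_left₀ (norm_nonneg _) hn 2
    _ = ∑ y, ∑ ν, (((a ν y)ᴴ * a ν y).trace).re := Real.sq_sqrt hnn

variable [NeZero N] {m : ℕ}

/-- ★★ **Coercivity in the norm of the chart at the decorated twist-eating ladders**: `4 sin²(π/(N(m+1))) · ‖a‖² ≤ D²chartAction(0)(a, a)`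
for traceless skew-Hermitian Coulomb-gauge `a` — the shape of `hpos`∕`hcoer` of the Laplace-method theorems, per vacuum, uniformly in `L, T`.
[cite: Breitung1994, Thm 41 (positive definite Hessian at the minimum)] [cite: GarciaperezGonzalezarroyoOkawa2017, §2.2] -/
theorem hessian_chartAction_coercive_norm_ladder {n₂' n₃' : ℕ} {A B : Matrix (Fin N) (Fin N) ℂ} {ω : ℂ}
    (hAu : A ∈ Matrix.unitaryGroup (Fin N) ℂ) (hBu : B ∈ Matrix.unitaryGroup (Fin N) ℂ) (hω : IsPrimitiveRoot ω N) (hAB : A * B = ω • (B * A))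
    {c₂ c₃ : ℂ} (hc₂ : star c₂ * c₂ = 1) (hc₃ : star c₃ * c₃ = 1)
    {c : FinTorusSite (m + 1) (m + 1) n₂' n₃' → Fin 4 → Fin 4 → ℂ} (hc : ∀ x μ ν, star (c x μ ν) * c x μ ν = 1)
    (heat : ∀ (x : FinTorusSite (m + 1) (m + 1) n₂' n₃') (μ ν : Fin 4), μ < ν →
      bgPlaq (ladderField ![A, B, c₂ • (1 : Matrix (Fin N) (Fin N) ℂ), c₃ • (1 : Matrix (Fin N) (Fin N) ℂ)]) x μ ν =
        star (c x μ ν) • (1 : Matrix (Fin N) (Fin N) ℂ))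
    {a : Fin 4 → FinTorusSite (m + 1) (m + 1) n₂' n₃' → Matrix (Fin N) (Fin N) ℂ}
    (hskew : ∀ μ x, (a μ x)ᴴ = -a μ x) (htr : ∀ μ x, (a μ x).trace = 0)
    (hdiv : ∀ x, covDiv (ladderField ![A, B, c₂ • (1 : Matrix (Fin N) (Fin N) ℂ), c₃ • (1 : Matrix (Fin N) (Fin N) ℂ)]) a x = 0) :
    4 * Real.sin (Real.pi / ((N : ℝ) * (m + 1 : ℕ))) ^ 2 * ‖a‖ ^ 2 ≤
      fderiv ℝ (fderiv ℝ (chartAction (ladderField ![A, B, c₂ • (1 : Matrix (Fin N) (Fin N) ℂ),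
        c₃ • (1 : Matrix (Fin N) (Fin N) ℂ)]) c)) 0 a a := by
  refine le_trans ?_ (hessian_chartAction_coercive_ladder hAu hBu hω hAB hc₂ hc₃ hc heat hskew htr hdiv)
  exact mul_le_mul_of_nonneg_left (norm_sq_le_sum_hsS a) (by positivity)

end Norm

end Summit.QuantumFields.YangMills.Cruxes.IRcof.TwistedSlab

end
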